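import Summits.QuantumFields.YangMills.Theorems.BalabanUVNodesN20OverAgeRefreshProcessAtClassWeights

/-!
# BalabanUVNodes ∕ node N19 (NE7) — THE MODELLING LETTER `hmodel` FROM THE PEIERLS LETTERS: the depth ∕ position composition §14.9 → §14.6 COMPILED
# (idea-3's hellinger road, letter (V‑a); plugs BY NAME into dag-n20-w5's p621610 ∕ p622199)

Cell `pub-ymgap` (HUMAN RULING D-0062 Track A ∕ director-ym R399 (3a) second-wave width seats), WIDTH SEAT `pub-ymgap-dag-n19-w4` (node n19 = NE7),
generation g7, CLAIM-1 ∕ INTENT-1 (bus 2026-08-28T09:36:15Z, INBOX l.35341) as re-scoped by DECL-DELTA-1 (the one-depth Peierls lemmas landed meanwhile in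
p622199 §7 and are CITED BY NAME, not restated).  Key item K3⁷ `SpineGivenEndpointR13SepCoPH` (stmt-QuantumFields-20544; skeleton of record v5 941dddb108cbaacf,
stub 2 `stub_expansion13H`); filed `--kind proof --supports … --as helper`.  COUNT-NEUTRAL.  THEOREMS ONLY (0 `def`, 0 `instance`, 0 `notation`, 0 `sorry`).
ADDITIVE — imports dag-n20-w5 g4's p622199 `…N20OverAgeRefreshProcessAtClassWeights` ONLY (through it p621610 `…N20OverAgeRefreshProcess` and Mathlib).

WHY.  p621610 (`wildMass_rate_of_refreshProcess` ∕ `wildMass_summable_of_refreshProcess`) turns the refresh-process letters of idea-3's memo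
`OVERAGE-RATE-READING-idea3-g13.md` §3(d)–(e) into the (V‑a) binder block `∃ wm ≥ 0, Summable √wm, wild K t ≤ wm K` of the road's K-summation
(dag-n19-w4 g6 p618979 `affinityDefectLetter_of_tameTilts`) — GIVEN its ONE modelling hypothesis `hmodel`: «the over-aged one-run class mass is at most
`C₀` × any upper bound of the partial sums `Σ_{m<M} 𝟙[x ≤ m]·e^{Λm}·(pattern sum of depth m at over-age m − b)`».  p622199 §7 (`overagedRelMass_le_patternSum`,
idea-3 g14's kernel ED.3 §14.9 re-proved def-free) derives the SHAPE of `hmodel` at ONE birth datum from the Peierls ∕ polymer-gas inequality: under a down-closed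
factorising representation (KR-dc) and the pendency containment (PEND) the RELATIVE over-aged mass is at most the pattern sum.  CRIT-1 g6's re-price
(`CRIT-1-REPRICE-hellinger-ed6-refresh-kernel-ed3.md`, C4) records what that «DOES NOT BUY: the composition §14.9 → §14.6 over depths with the positions ∕ density
bookkeeping `C₀·e^{Λm}` is NOT compiled (stays a letter)», and its N7 asks a porting width seat to «state `hmodel`'s supplier as THREE letters (KR-dc) + (PEND) +
the positions count explicitly».  THIS FILE compiles exactly that composition and plugs it into p621610 BY NAME:
* §1 ★★ `modellingLetter_of_peierlsLetters` — ONE `(K,t)`, THE COMPOSITION.  Letters: (BIRTH) a union bound over birth depths `m < M` beyond the threshold `x`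
  and birth positions `p ∈ Pos m` of the RELATIVE over-aged masses, `wild ≤ C₀·Σ_{m<M} 𝟙[x ≤ m]·Σ_{p∈Pos m} (Σ_{X∈𝒜 m p, Over} A)∕(Σ_{𝒜 m p} A)` with `C₀ ≥ 0`
  (birth density × volume); (POS) `#(Pos m) ≤ e^{Λ m}`; per birth datum `(m,p)` the letters of p622199's `overagedRelMass_le_patternSum` — (KR-dc) (down-closed
  `𝒜 m p`, `A m p ≥ 0`, factorisation with deficit over the position-uniform factors `w m ≥ 0`) and (PEND) at over-age `m − b` inside `U m` — CONSUMED BY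
  NAME ⇒ EXACTLY the `hmodel` binder of p621610's `wildMass_rate_of_refreshProcess` (the pattern sum in its spelling).
* §2 ★★★ `modellingLetterAlongK_of_peierlsLetters` — ALL `K ≥ 1`, `|t| ≤ l₀`, threshold `x_K = b + κ₁·log K`, depth horizon `M K`: EXACTLY the `hmodel` binder
  of `wildMass_summable_of_refreshProcess` ∕ `wildMass_rateAlongK_of_refreshProcess` ∕ `wildMass_summableOne_of_refreshProcess` (and, per run, of p622199's
  `classWildMass_summable_of_refreshProcess` ∕ `affinityDefectLetter_of_refreshProcesses_and_tameTilts` — their `hmodel` ∕ `hmodelA` ∕ `hmodelB` are this binder).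
* §3 PLUGS BY NAME into p621610 with `hmodel` DISCHARGED: ★★★ `wildMass_summable_of_peierlsLetters` (the (V‑a) block, exponent 2);
  `wildMass_summableOne_of_peierlsLetters` (exponent 1 — `window-key-core`'s booked-mass letter (AC)); `wildMass_rateAlongK_of_peierlsLetters` (the rate).
* §4 toy (A6): the letters of §1 are jointly inhabited NON-VACUOUSLY — one refresh event of factor `q`, one position, one depth: (BIRTH) holds with equality at
  `wild = q∕(1+q)`, and §1 returns `q∕(1+q) ≤ q`.
CREDIT.  The refresh process, §14.9 and the dictionary to [LF‑II]: idea-3 g13∕g14 (`Cruxes/…/RefreshProcessSketch.lean`, not importable); the importable ports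
p621610 ∕ p622199 (incl. §7 Peierls): dag-n20-w5 g4 — CONSUMED BY NAME, nothing restated; the pricing (C4, N6–N8): CRIT-1 g6.  New here: §1–§3 (the composition
CRIT-1 C4 lists as «not compiled») and the toy.  `w ≥ 0` is asked GLOBALLY in `j` (as p622199 §7 asks it; net refresh factors are nonnegative by nature) and
restricted to `U` where p621610 wants it.

HONEST FRAMING.  [folklore] finite sums on HYPOTHESIS SHAPES.  EVERY letter — the down-closed factorising weight systems (KR-dc) («one run's keyed class weight
at a birth datum, relative to the small-field background, is a down-closed positive weight system over refresh-event sets with factorisation-with-deficit over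
refresh events», idea-3's READING of [LF‑II] (1.79)–(1.83) + [LF‑I] (1.1)–(1.3)), the pendency containment (PEND) ([LF‑II] p.385 L24 – p.386 L13, READ), the
positions count (POS), the birth union bound (BIRTH) with its density constant `C₀`, and p621610's factor ∕ price ∕ epoch ∕ rate ∕ entropy letters — is a
HYPOTHESIS produced by nobody, NOT asserted here and NOT kernel-checked against any datum ((KR-dc) is typable only once a skeleton exposes keyed carriers at the
window key — plan D84, v6 `kr := wkey`).  What moves from «stays a letter» to «kernel-checked, importable» is the IMPLICATION (KR-dc) + (PEND) + (POS) + (BIRTH)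
⇒ `hmodel` and its plug — nothing else.  NO estimate of Bałaban's programme is proved; nothing of Bałaban's asserted or instantiated (no `Provisos₁₃CoPH` tuple —
K0⁷ OPEN); (V‑b) = (YG), (R′), (R‑c) untouched and UNPRINTED for d = 4; NE7 ∕ NE7b ∕ NE7c NOT PRINTED as two-run statements for d = 4 and NOT proved; N19 ∕ N20
NOT discharged; K3⁷ OPEN, v5 STANDS, not claimed; no summit statement is proved by this seat; counts UNMOVED.  One finite four-torus programme at fixed ε — NOT ℝ⁴,
NOT infinite volume, NOT OS, NOT a mass gap, NOT the Clay problem (R4 closes the conditional finite-𝕋⁴ rung `BalabanLadder.UV` only).  0 `def`; 0 `sorry`; standard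
axioms; no cite tags.
-/

noncomputable section

namespace Summit.QuantumFields.YangMills.BalabanUVNodes.N19ModellingLetterOfPeierlsDomination
open Finset
open Summit.QuantumFields.YangMills.BalabanUVNodes.N20OverAgeRefreshProcess
  (wildMass_rateAlongK_of_refreshProcess wildMass_summable_of_refreshProcess wildMass_summableOne_of_refreshProcess)
open Summit.QuantumFields.YangMills.BalabanUVNodes.N20OverAgeRefreshProcessAtClassWeights (overagedRelMass_le_patternSum)

/-! ## §1 ONE `(K,t)` — THE DEPTH ∕ POSITION COMPOSITION: (KR-dc) + (PEND) + (POS) + (BIRTH) ⇒ `hmodel` -/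

section Composition
variable {α : Type*} [DecidableEq α] {π : Type*}

/-- **★★ THE MODELLING LETTER AT ONE `(K,t)` FROM THE PEIERLS LETTERS.**  Data per birth depth `m`: refresh events `U m`, position-uniform factors `w m ≥ 0`,
epoch lengths `ℓ m`; birth positions `Pos m` with (POS) `#(Pos m) ≤ e^{Λ m}`; per `(m, p)` a weight system — histories `𝒜 m p` (DOWN-CLOSED finite family of
refresh-event sets), weights `A m p ≥ 0` on it, the deficit factorisation `A X ≤ (Π_{j∈S} w m j)·A (X ∖ S)` for `S ⊆ X ∈ 𝒜 m p` (KR-dc), and the over-aged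
histories `Over m p` with the pendency containment at over-age `m − b` inside `U m` (PEND) — the letters of p622199's `overagedRelMass_le_patternSum`; and
(BIRTH): the over-aged one-run mass `wild` is at most `C₀ ≥ 0` times the sum over birth depths `m < M` beyond the threshold `x` and positions `p ∈ Pos m` of
the RELATIVE over-aged masses.  Conclusion — EXACTLY the `hmodel` binder of p621610's `wildMass_rate_of_refreshProcess`: `wild ≤ C₀·s` for every upper bound
`s` of the partial sums `Σ_{m<M'} 𝟙[x ≤ m]·e^{Λm}·Σ_{S ⊆ U m, m − b ≤ Σ_S ℓ} Π_S w`. -/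
theorem modellingLetter_of_peierlsLetters (U : ℕ → Finset α) (w ℓ : ℕ → α → ℝ) (hw0 : ∀ m j, 0 ≤ w m j)
    {Λ : ℝ} (b x : ℝ) (Pos : ℕ → Finset π) (hpos : ∀ m, ((Pos m).card : ℝ) ≤ Real.exp (Λ * m))
    (𝒜 : ℕ → π → Finset (Finset α)) (A : ℕ → π → Finset α → ℝ)
    (hA : ∀ m p, ∀ X ∈ 𝒜 m p, 0 ≤ A m p X) (hdown : ∀ m p, ∀ X ∈ 𝒜 m p, ∀ Y, Y ⊆ X → Y ∈ 𝒜 m p)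
    (hfac : ∀ m p, ∀ X ∈ 𝒜 m p, ∀ S, S ⊆ X → A m p X ≤ (∏ j ∈ S, w m j) * A m p (X \ S))
    (Over : ℕ → π → Finset α → Prop) [∀ m p, DecidablePred (Over m p)]
    (hpend : ∀ m p, ∀ X ∈ 𝒜 m p, Over m p X → ∃ S, S ⊆ U m ∧ ((m : ℝ) - b ≤ ∑ j ∈ S, ℓ m j) ∧ S ⊆ X)
    {wild C₀ : ℝ} (hC₀ : 0 ≤ C₀) (M : ℕ)
    (hbirth : wild ≤ C₀ * ∑ m ∈ range M,
      (if x ≤ (m : ℝ) then ∑ p ∈ Pos m, (∑ X ∈ 𝒜 m p with Over m p X, A m p X) / (∑ Y ∈ 𝒜 m p, A m p Y) else 0)) :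
    ∀ s : ℝ, (∀ M' : ℕ, ∑ m ∈ range M',
        (if x ≤ (m : ℝ) then Real.exp (Λ * m) *
          ∑ S ∈ (U m).powerset with ((m : ℝ) - b ≤ ∑ j ∈ S, ℓ m j), ∏ j ∈ S, w m j else 0) ≤ s) →
      wild ≤ C₀ * s := by
  intro s hs
  -- per birth datum: relative over-aged mass ≤ pattern sum (p622199 §7 BY NAME); (POS) turns the sum over positions into `e^{Λ m}`
  have hP : ∀ m : ℕ, 0 ≤ ∑ S ∈ (U m).powerset with ((m : ℝ) - b ≤ ∑ j ∈ S, ℓ m j), ∏ j ∈ S, w m j := fun m =>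
    sum_nonneg fun S _ => prod_nonneg fun j _ => hw0 m j
  have hrel : ∀ (m : ℕ) (p : π), (∑ X ∈ 𝒜 m p with Over m p X, A m p X) / (∑ Y ∈ 𝒜 m p, A m p Y)
      ≤ ∑ S ∈ (U m).powerset with ((m : ℝ) - b ≤ ∑ j ∈ S, ℓ m j), ∏ j ∈ S, w m j := fun m p =>
    overagedRelMass_le_patternSum (𝒜 m p) (hdown m p) (A m p) (hA m p) (w m) (hw0 m) (hfac m p)
      (U m) (ℓ m) ((m : ℝ) - b) (Over m p) (hpend m p)
  have hterm : ∀ m : ℕ,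
      (if x ≤ (m : ℝ) then ∑ p ∈ Pos m, (∑ X ∈ 𝒜 m p with Over m p X, A m p X) / (∑ Y ∈ 𝒜 m p, A m p Y) else 0)
      ≤ (if x ≤ (m : ℝ) then Real.exp (Λ * m) *
          ∑ S ∈ (U m).powerset with ((m : ℝ) - b ≤ ∑ j ∈ S, ℓ m j), ∏ j ∈ S, w m j else 0) := by
    intro m
    by_cases hxm : x ≤ (m : ℝ)
    · rw [if_pos hxm, if_pos hxm]
      calc ∑ p ∈ Pos m, (∑ X ∈ 𝒜 m p with Over m p X, A m p X) / (∑ Y ∈ 𝒜 m p, A m p Y)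
          ≤ ∑ _p ∈ Pos m, ∑ S ∈ (U m).powerset with ((m : ℝ) - b ≤ ∑ j ∈ S, ℓ m j), ∏ j ∈ S, w m j :=
            sum_le_sum fun p _ => hrel m p
        _ = ((Pos m).card : ℝ) * ∑ S ∈ (U m).powerset with ((m : ℝ) - b ≤ ∑ j ∈ S, ℓ m j), ∏ j ∈ S, w m j := by
            rw [sum_const, nsmul_eq_mul]
        _ ≤ Real.exp (Λ * m) * ∑ S ∈ (U m).powerset with ((m : ℝ) - b ≤ ∑ j ∈ S, ℓ m j), ∏ j ∈ S, w m j :=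
            mul_le_mul_of_nonneg_right (hpos m) (hP m)
    · rw [if_neg hxm, if_neg hxm]
  calc wild ≤ C₀ * ∑ m ∈ range M, (if x ≤ (m : ℝ) then
          ∑ p ∈ Pos m, (∑ X ∈ 𝒜 m p with Over m p X, A m p X) / (∑ Y ∈ 𝒜 m p, A m p Y) else 0) := hbirth
    _ ≤ C₀ * ∑ m ∈ range M, (if x ≤ (m : ℝ) then Real.exp (Λ * m) *
          ∑ S ∈ (U m).powerset with ((m : ℝ) - b ≤ ∑ j ∈ S, ℓ m j), ∏ j ∈ S, w m j else 0) :=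
        mul_le_mul_of_nonneg_left (sum_le_sum fun m _ => hterm m) hC₀
    _ ≤ C₀ * s := mul_le_mul_of_nonneg_left (hs M) hC₀

end Composition

/-! ## §2 ALL `K ≥ 1`, `|t| ≤ l₀` — the `hmodel` binder of `wildMass_summable_of_refreshProcess`, verbatim -/

section AlongK
variable {α : Type*} [DecidableEq α] {π : Type*}

/-- **★★★ THE MODELLING LETTER ALONG `K` FROM THE PEIERLS LETTERS.**  The data of `modellingLetter_of_peierlsLetters` indexed by the run `K` and the source `t`
(refresh events `U K t m`, factors `w K t m ≥ 0`, epochs `ℓ K t m`; positions `Pos K m` with `#(Pos K m) ≤ e^{Λm}`; weight systems `𝒜 ∕ A` and over-aged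
predicates `Over` at `(K,t,m,p)` with (KR-dc) and (PEND) at over-age `m − b`; (BIRTH) with depth horizon `M K` and the threshold `x_K = b + κ₁·log K`), asked
for `|t| ≤ l₀` and `K ≥ 1`.  Conclusion — EXACTLY the `hmodel` binder of p621610's `wildMass_summable_of_refreshProcess` (and `…rateAlongK…`, `…summableOne…`;
per run, p622199's `hmodel` ∕ `hmodelA` ∕ `hmodelB`). -/
theorem modellingLetterAlongK_of_peierlsLetters {l₀ : ℝ} (wild : ℕ → ℝ → ℝ) {Λ κ₁ C₀ : ℝ} (b : ℝ) (hC₀ : 0 ≤ C₀)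
    (U : ℕ → ℝ → ℕ → Finset α) (w ℓ : ℕ → ℝ → ℕ → α → ℝ) (hw0 : ∀ K t m j, 0 ≤ w K t m j)
    (Pos : ℕ → ℕ → Finset π) (hpos : ∀ K m, ((Pos K m).card : ℝ) ≤ Real.exp (Λ * m))
    (𝒜 : ℕ → ℝ → ℕ → π → Finset (Finset α)) (A : ℕ → ℝ → ℕ → π → Finset α → ℝ)
    (hA : ∀ K t m p, ∀ X ∈ 𝒜 K t m p, 0 ≤ A K t m p X)
    (hdown : ∀ K t m p, ∀ X ∈ 𝒜 K t m p, ∀ Y, Y ⊆ X → Y ∈ 𝒜 K t m p)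
    (hfac : ∀ K t m p, ∀ X ∈ 𝒜 K t m p, ∀ S, S ⊆ X → A K t m p X ≤ (∏ j ∈ S, w K t m j) * A K t m p (X \ S))
    (Over : ℕ → ℝ → ℕ → π → Finset α → Prop) [∀ K t m p, DecidablePred (Over K t m p)]
    (hpend : ∀ K t m p, ∀ X ∈ 𝒜 K t m p, Over K t m p X → ∃ S, S ⊆ U K t m ∧ ((m : ℝ) - b ≤ ∑ j ∈ S, ℓ K t m j) ∧ S ⊆ X)
    (M : ℕ → ℕ)
    (hbirth : ∀ (K : ℕ) (t : ℝ), |t| ≤ l₀ → 1 ≤ K → wild K t ≤ C₀ * ∑ m ∈ range (M K),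
      (if b + κ₁ * Real.log (K : ℝ) ≤ (m : ℝ) then
        ∑ p ∈ Pos K m, (∑ X ∈ 𝒜 K t m p with Over K t m p X, A K t m p X) / (∑ Y ∈ 𝒜 K t m p, A K t m p Y) else 0)) :
    ∀ (K : ℕ) (t : ℝ), |t| ≤ l₀ → 1 ≤ K → ∀ s : ℝ,
      (∀ M' : ℕ, ∑ m ∈ range M', (if b + κ₁ * Real.log (K : ℝ) ≤ (m : ℝ) then
          Real.exp (Λ * m) * ∑ S ∈ (U K t m).powerset with ((m : ℝ) - b ≤ ∑ j ∈ S, ℓ K t m j), ∏ j ∈ S, w K t m j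
        else 0) ≤ s) →
      wild K t ≤ C₀ * s :=
  fun K t ht hK =>
    modellingLetter_of_peierlsLetters (U K t) (w K t) (ℓ K t) (hw0 K t) b (b + κ₁ * Real.log (K : ℝ)) (Pos K) (hpos K)
      (𝒜 K t) (A K t) (hA K t) (hdown K t) (hfac K t) (Over K t) (hpend K t) hC₀ (M K) (hbirth K t ht hK)

end AlongK

/-! ## §3 PLUGS BY NAME into p621610: the (V‑a) block, the exponent-1 edition, the rate — with `hmodel` DISCHARGED -/

section Plugs
variable {α : Type*} [DecidableEq α] {π : Type*}

/-- **★★★ THE (V‑a) BINDER BLOCK FROM THE PEIERLS LETTERS** = p621610's `wildMass_summable_of_refreshProcess` with its modelling hypothesis `hmodel` supplied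
by `modellingLetterAlongK_of_peierlsLetters`.  Letters: `wild K t ≤ 1` on the window; rate `θ ≥ 0`, block entropy and leak with `Λ + ζ < θ`,
`κ₁·(θ − Λ − ζ) > 2`, `C₀ ≥ 0`; factors `0 ≤ w ≤ e^{−P}` (on `U`), `θ·ℓ ≤ P∕2`, entropy `Σ_U e^{−P∕2} ≤ Z₀ + ζ m`; (POS), (KR-dc), (PEND), (BIRTH).
Conclusion: `∃ wm ≥ 0, Summable (√wm) ∧ ∀ K t, |t| ≤ l₀ → wild K t ≤ wm K` — the `(wm, hwm, hwild, hws)` binders of p618979's `affinityDefectLetter_of_tameTilts`. -/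
theorem wildMass_summable_of_peierlsLetters {l₀ : ℝ} (wild : ℕ → ℝ → ℝ)
    (hwild1 : ∀ K t, |t| ≤ l₀ → wild K t ≤ 1)
    {θ Λ ζ κ₁ Z₀ C₀ : ℝ} (b : ℝ) (hθ : 0 ≤ θ) (hΛθ : Λ + ζ < θ) (hκ : 2 < κ₁ * (θ - Λ - ζ)) (hC₀ : 0 ≤ C₀)
    (U : ℕ → ℝ → ℕ → Finset α) (w ℓ P : ℕ → ℝ → ℕ → α → ℝ)
    (hw0 : ∀ K t m j, 0 ≤ w K t m j)
    (hw : ∀ K t m, ∀ j ∈ U K t m, w K t m j ≤ Real.exp (-P K t m j))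
    (hθP : ∀ K t m, ∀ j ∈ U K t m, θ * ℓ K t m j ≤ P K t m j / 2)
    (hZ : ∀ K t (m : ℕ), ∑ j ∈ U K t m, Real.exp (-(P K t m j / 2)) ≤ Z₀ + ζ * m)
    (Pos : ℕ → ℕ → Finset π) (hpos : ∀ K m, ((Pos K m).card : ℝ) ≤ Real.exp (Λ * m))
    (𝒜 : ℕ → ℝ → ℕ → π → Finset (Finset α)) (A : ℕ → ℝ → ℕ → π → Finset α → ℝ)
    (hA : ∀ K t m p, ∀ X ∈ 𝒜 K t m p, 0 ≤ A K t m p X)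
    (hdown : ∀ K t m p, ∀ X ∈ 𝒜 K t m p, ∀ Y, Y ⊆ X → Y ∈ 𝒜 K t m p)
    (hfac : ∀ K t m p, ∀ X ∈ 𝒜 K t m p, ∀ S, S ⊆ X → A K t m p X ≤ (∏ j ∈ S, w K t m j) * A K t m p (X \ S))
    (Over : ℕ → ℝ → ℕ → π → Finset α → Prop) [∀ K t m p, DecidablePred (Over K t m p)]
    (hpend : ∀ K t m p, ∀ X ∈ 𝒜 K t m p, Over K t m p X → ∃ S, S ⊆ U K t m ∧ ((m : ℝ) - b ≤ ∑ j ∈ S, ℓ K t m j) ∧ S ⊆ X)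
    (M : ℕ → ℕ)
    (hbirth : ∀ (K : ℕ) (t : ℝ), |t| ≤ l₀ → 1 ≤ K → wild K t ≤ C₀ * ∑ m ∈ range (M K),
      (if b + κ₁ * Real.log (K : ℝ) ≤ (m : ℝ) then
        ∑ p ∈ Pos K m, (∑ X ∈ 𝒜 K t m p with Over K t m p X, A K t m p X) / (∑ Y ∈ 𝒜 K t m p, A K t m p Y) else 0)) :
    ∃ wm : ℕ → ℝ, (∀ K, 0 ≤ wm K) ∧ Summable (fun K => Real.sqrt (wm K)) ∧
      ∀ K t, |t| ≤ l₀ → wild K t ≤ wm K :=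
  wildMass_summable_of_refreshProcess wild hwild1 b hθ hΛθ hκ hC₀ U w ℓ P (fun K t m j _ => hw0 K t m j) hw hθP hZ
    (modellingLetterAlongK_of_peierlsLetters wild b hC₀ U w ℓ hw0 Pos hpos 𝒜 A hA hdown hfac Over hpend M hbirth)

/-- [folklore] **EXPONENT 1** ((AC) of `window-key-core`) = p621610's `wildMass_summableOne_of_refreshProcess`, `hmodel` supplied by the Peierls letters. -/
theorem wildMass_summableOne_of_peierlsLetters {l₀ : ℝ} (wild : ℕ → ℝ → ℝ)
    (hwild1 : ∀ K t, |t| ≤ l₀ → wild K t ≤ 1)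
    {θ Λ ζ κ₁ Z₀ C₀ : ℝ} (b : ℝ) (hθ : 0 ≤ θ) (hΛθ : Λ + ζ < θ) (hκ : 1 < κ₁ * (θ - Λ - ζ)) (hC₀ : 0 ≤ C₀)
    (U : ℕ → ℝ → ℕ → Finset α) (w ℓ P : ℕ → ℝ → ℕ → α → ℝ)
    (hw0 : ∀ K t m j, 0 ≤ w K t m j)
    (hw : ∀ K t m, ∀ j ∈ U K t m, w K t m j ≤ Real.exp (-P K t m j))
    (hθP : ∀ K t m, ∀ j ∈ U K t m, θ * ℓ K t m j ≤ P K t m j / 2)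
    (hZ : ∀ K t (m : ℕ), ∑ j ∈ U K t m, Real.exp (-(P K t m j / 2)) ≤ Z₀ + ζ * m)
    (Pos : ℕ → ℕ → Finset π) (hpos : ∀ K m, ((Pos K m).card : ℝ) ≤ Real.exp (Λ * m))
    (𝒜 : ℕ → ℝ → ℕ → π → Finset (Finset α)) (A : ℕ → ℝ → ℕ → π → Finset α → ℝ)
    (hA : ∀ K t m p, ∀ X ∈ 𝒜 K t m p, 0 ≤ A K t m p X)
    (hdown : ∀ K t m p, ∀ X ∈ 𝒜 K t m p, ∀ Y, Y ⊆ X → Y ∈ 𝒜 K t m p)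
    (hfac : ∀ K t m p, ∀ X ∈ 𝒜 K t m p, ∀ S, S ⊆ X → A K t m p X ≤ (∏ j ∈ S, w K t m j) * A K t m p (X \ S))
    (Over : ℕ → ℝ → ℕ → π → Finset α → Prop) [∀ K t m p, DecidablePred (Over K t m p)]
    (hpend : ∀ K t m p, ∀ X ∈ 𝒜 K t m p, Over K t m p X → ∃ S, S ⊆ U K t m ∧ ((m : ℝ) - b ≤ ∑ j ∈ S, ℓ K t m j) ∧ S ⊆ X)
    (M : ℕ → ℕ)
    (hbirth : ∀ (K : ℕ) (t : ℝ), |t| ≤ l₀ → 1 ≤ K → wild K t ≤ C₀ * ∑ m ∈ range (M K),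
      (if b + κ₁ * Real.log (K : ℝ) ≤ (m : ℝ) then
        ∑ p ∈ Pos K m, (∑ X ∈ 𝒜 K t m p with Over K t m p X, A K t m p X) / (∑ Y ∈ 𝒜 K t m p, A K t m p Y) else 0)) :
    ∃ wm : ℕ → ℝ, (∀ K, 0 ≤ wm K) ∧ Summable wm ∧ ∀ K t, |t| ≤ l₀ → wild K t ≤ wm K :=
  wildMass_summableOne_of_refreshProcess wild hwild1 b hθ hΛθ hκ hC₀ U w ℓ P (fun K t m j _ => hw0 K t m j) hw hθP hZ
    (modellingLetterAlongK_of_peierlsLetters wild b hC₀ U w ℓ hw0 Pos hpos 𝒜 A hA hdown hfac Over hpend M hbirth)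

/-- [folklore] **THE RATE** `K^{−κ₁(θ−Λ−ζ)}` = p621610's `wildMass_rateAlongK_of_refreshProcess`, `hmodel` supplied by the Peierls letters. -/
theorem wildMass_rateAlongK_of_peierlsLetters {l₀ : ℝ} (wild : ℕ → ℝ → ℝ)
    {θ Λ ζ κ₁ Z₀ C₀ : ℝ} (b : ℝ) (hθ : 0 ≤ θ) (hΛθ : Λ + ζ < θ) (hC₀ : 0 ≤ C₀)
    (U : ℕ → ℝ → ℕ → Finset α) (w ℓ P : ℕ → ℝ → ℕ → α → ℝ)
    (hw0 : ∀ K t m j, 0 ≤ w K t m j)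
    (hw : ∀ K t m, ∀ j ∈ U K t m, w K t m j ≤ Real.exp (-P K t m j))
    (hθP : ∀ K t m, ∀ j ∈ U K t m, θ * ℓ K t m j ≤ P K t m j / 2)
    (hZ : ∀ K t (m : ℕ), ∑ j ∈ U K t m, Real.exp (-(P K t m j / 2)) ≤ Z₀ + ζ * m)
    (Pos : ℕ → ℕ → Finset π) (hpos : ∀ K m, ((Pos K m).card : ℝ) ≤ Real.exp (Λ * m))
    (𝒜 : ℕ → ℝ → ℕ → π → Finset (Finset α)) (A : ℕ → ℝ → ℕ → π → Finset α → ℝ)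
    (hA : ∀ K t m p, ∀ X ∈ 𝒜 K t m p, 0 ≤ A K t m p X)
    (hdown : ∀ K t m p, ∀ X ∈ 𝒜 K t m p, ∀ Y, Y ⊆ X → Y ∈ 𝒜 K t m p)
    (hfac : ∀ K t m p, ∀ X ∈ 𝒜 K t m p, ∀ S, S ⊆ X → A K t m p X ≤ (∏ j ∈ S, w K t m j) * A K t m p (X \ S))
    (Over : ℕ → ℝ → ℕ → π → Finset α → Prop) [∀ K t m p, DecidablePred (Over K t m p)]
    (hpend : ∀ K t m p, ∀ X ∈ 𝒜 K t m p, Over K t m p X → ∃ S, S ⊆ U K t m ∧ ((m : ℝ) - b ≤ ∑ j ∈ S, ℓ K t m j) ∧ S ⊆ X)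
    (M : ℕ → ℕ)
    (hbirth : ∀ (K : ℕ) (t : ℝ), |t| ≤ l₀ → 1 ≤ K → wild K t ≤ C₀ * ∑ m ∈ range (M K),
      (if b + κ₁ * Real.log (K : ℝ) ≤ (m : ℝ) then
        ∑ p ∈ Pos K m, (∑ X ∈ 𝒜 K t m p with Over K t m p X, A K t m p X) / (∑ Y ∈ 𝒜 K t m p, A K t m p Y) else 0)) :
    ∀ (K : ℕ) (t : ℝ), |t| ≤ l₀ → 1 ≤ K →
      wild K t ≤ C₀ * (Real.exp (Z₀ + θ * b) * (Real.exp (-((θ - Λ - ζ) * b)) / (1 - Real.exp (-(θ - Λ - ζ)))))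
        * Real.exp (-(κ₁ * (θ - Λ - ζ) * Real.log K)) :=
  wildMass_rateAlongK_of_refreshProcess wild b hθ hΛθ U w ℓ P (fun K t m j _ => hw0 K t m j) hw hθP hZ
    (modellingLetterAlongK_of_peierlsLetters wild b hC₀ U w ℓ hw0 Pos hpos 𝒜 A hA hdown hfac Over hpend M hbirth)

end Plugs

/-! ## §4 Toy (A6): the letters of §1 are jointly inhabited, non-vacuously -/

section Toys

/-- Toy (A6): ONE refresh event (`α = Unit`) of factor `q ≥ 0` opening a unit epoch at depth `0` (`U 0 = {()}`, no events at other depths), budget `b = −1`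
(depth `0` is over-aged by `1`), threshold `x = 0`, `Λ = 0`, ONE birth position (`π = Unit`), histories `𝒜 = {∅, {()}}` (down-closed) with weights `A ∅ = 1`,
`A {()} = q` (the deficit letter holds, with equality on `S = X`), over-aged := «depth `0` and contains the event», `C₀ = 1`, one depth (`M = 1`).  (BIRTH) holds
with EQUALITY at `wild = q ∕ (1 + q)`; every partial sum of the priced series is `≤ q` (depth `0` contributes the pattern `{()}` of price `q`, deeper depths have
no events and positive over-age); the composition returns `q∕(1+q) ≤ 1·q` — non-vacuously. -/
theorem toy_oneEvent {q : ℝ} (hq : 0 ≤ q) : q / (1 + q) ≤ 1 * q := by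
  have hU1 : ∀ X : Finset Unit, X.Nonempty → X = {()} := fun X h =>
    Finset.eq_singleton_iff_nonempty_unique_mem.2 ⟨h, fun y _ => Subsingleton.elim _ _⟩
  refine modellingLetter_of_peierlsLetters (α := Unit) (π := Unit)
    (fun m => if m = 0 then ({()} : Finset Unit) else ∅) (fun _ _ => q) (fun _ _ => (1 : ℝ)) (fun _ _ => hq)
    (Λ := 0) (-1) 0 (fun _ => ({()} : Finset Unit)) (fun m => ?_)
    (fun _ _ => ({∅, {()}} : Finset (Finset Unit))) (fun _ _ X => if X = ∅ then (1 : ℝ) else q)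
    (fun _ _ X _ => ?_) (fun _ _ X _ Y _ => ?_) (fun _ _ X _ S hSX => ?_)
    (fun m _ X => m = 0 ∧ () ∈ X) (fun m _ X _ hX => ?_) (wild := q / (1 + q)) zero_le_one 1 ?_ q (fun M' => ?_)
  · -- (POS): one position, `e^{0·m} = 1`
    simp
  · -- `A ≥ 0`
    show 0 ≤ (if X = ∅ then (1:ℝ) else q)
    split_ifs
    · exact zero_le_one
    · exact hq
  · -- down-closed: every `Y : Finset Unit` is `∅` or `{()}`
    rcases Finset.eq_empty_or_nonempty Y with h | h
    · simp [h]
    · simp [hU1 Y h]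
  · -- deficit factorisation with `w = q`
    show (if X = ∅ then (1:ℝ) else q) ≤ (∏ _j ∈ S, q) * (if X \ S = ∅ then (1:ℝ) else q)
    rcases Finset.eq_empty_or_nonempty S with hS | hS
    · subst hS; simp
    · have hS1 := hU1 S hS
      have hX1 := hU1 X (hS.mono hSX)
      subst hS1; subst hX1
      simp
  · -- (PEND): over-aged only at depth `0`, where the event `()` itself covers the over-age `0 − (−1) = 1`
    obtain ⟨hm, hmem⟩ := hX
    subst hm
    refine ⟨{()}, by simp, by simp, Finset.singleton_subset_iff.2 hmem⟩
  · -- (BIRTH) with equality: the relative over-aged mass at the one datum is `q ∕ (1 + q)`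
    rw [sum_range_one]
    have h1 : (({∅, {()}} : Finset (Finset Unit)).filter fun X => () ∈ X) = {{()}} := by decide
    simp only [Nat.cast_zero, le_refl, if_true, sum_singleton, one_mul, true_and]
    rw [h1, Finset.sum_pair (by decide)]
    simp
  · -- every partial sum is `≤ q`
    have hterm : ∀ m : ℕ, (if (0:ℝ) ≤ (m : ℝ) then Real.exp (0 * (m : ℝ)) *
        ∑ S ∈ (if m = 0 then ({()} : Finset Unit) else ∅).powerset with ((m : ℝ) - (-1) ≤ ∑ j ∈ S, (fun _ _ => (1:ℝ)) m j),
          ∏ j ∈ S, (fun _ _ => q) m j else 0) = if m = 0 then q else 0 := by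
      intro m
      rw [if_pos (Nat.cast_nonneg m), zero_mul, Real.exp_zero, one_mul]
      by_cases hm : m = 0
      · subst hm
        rw [if_pos rfl, if_pos rfl]
        have hp : ({()} : Finset Unit).powerset = {∅, {()}} := by decide
        rw [hp, Finset.filter_insert, Finset.filter_singleton]
        norm_num
      · rw [if_neg hm, if_neg hm, Finset.powerset_empty]
        have h1 : (({∅} : Finset (Finset Unit)).filter fun S => ((m:ℝ) - (-1) ≤ ∑ _j ∈ S, (1:ℝ))) = ∅ := by
          refine Finset.filter_eq_empty_iff.2 fun S hS => ?_
          rw [Finset.mem_singleton] at hS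
          subst hS
          rw [sum_empty, not_le]
          have : (0:ℝ) ≤ m := Nat.cast_nonneg m
          linarith
        rw [h1, sum_empty]
    rw [Finset.sum_congr rfl fun m _ => hterm m, Finset.sum_ite_eq']
    split_ifs
    · exact le_rfl
    · exact hq

end Toys

end Summit.QuantumFields.YangMills.BalabanUVNodes.N19ModellingLetterOfPeierlsDomination
end
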